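import Summits.CriticalPhenomena.PercolationContinuityZ3.Theorems.PercNearOneGluingNoHeavyLowerTailSahiJuntaSlotThree
import Summits.CriticalPhenomena.PercolationContinuityZ3.Theorems.PercNearOneGluingNoHeavyLowerTailSahiHittingSlotCylinder
import Summits.CriticalPhenomena.PercolationContinuityZ3.Theorems.PercNearOneGluingNoHeavyLowerTailSahiCombStrata
import Summits.CriticalPhenomena.PercolationContinuityZ3.Theorems.PercNearOneGluingNoHeavyLowerTailSahiC3CombCube

/-!
# `NoHeavyLowerTail` (crux stmt-CriticalPhenomena-4575): KAHN'S CONJECTURE 5 / SAHI'S `C₃` WHENEVER ONE SLOT DEPENDS ON AT MOST THREE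
# COORDINATES — one statement

Support file (cell `prim-l12`, seat P3, gen 4; `--supports stmt-CriticalPhenomena-4575`).  No `sorry`, no named facts, standard axioms.

**THEOREM (`sahiE_three_nonneg_of_determinedBy_card_le_three`).**  For every finite `ι`, every product weight `μ_p`, every `A ⊆ ι` with `|A| ≤ 3`,
every increasing event `H` determined by `A`, and ALL increasing events `U, V ⊆ 2^ι`:  `E₃(1_H, 1_U, 1_V) ≥ 0`  (law form
`prodBernoulli_sahiE3_nonneg_of_determinedBy_card_le_three`).  Kahn [Kahn2022, Conj. 5] / Sahi [Sahi2008, Conj. 5] ask this for three arbitrary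
increasing events; here one slot is a `≤ 3`-junta and the other two are unrestricted, in every dimension.

Assembly of the eight types of increasing events on three coordinates: if `|ι| ≤ 3` the cube theorem `…SahiC3CombCube` applies; otherwise `A`
extends to a block `{a,b,c}` of three distinct coordinates, `H = {ω | f(a∈ω, b∈ω, c∈ω)}` for the Boolean function `f` read off the bitmask
`M ∈ upsN 3` of its pattern event, and the twenty bitmasks are dispatched to: the trivial slots (`M = 0, 255`), CYLINDERS (`…SahiCombStrata`,
`M ∈ {128,136,160,192,170,204,240}`), HITTING events (`…SahiHittingSlot`, `M ∈ {238,250,252,254}`), CYLINDER ∩ HITTING (`…SahiHittingSlotCylinder`,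
`M ∈ {168,200,224}`), and the two transport-certificate slots of `…SahiJuntaSlotThree`: `a ∨ bc` (`M ∈ {234,236,248}`) and MAJORITY (`M = 232`).
[cite: Kahn2022, Conj. 5 (arXiv p. 3); Sahi2008, Conj. 5; LiebSahi2021, eq. (2.1)]
-/

noncomputable section

open scoped Classical

namespace Summit.CriticalPhenomena.PercolationContinuityZ3.Theorems

namespace SahiJuntaSlotThree

open Finset
open SahiHittingSlot SahiTransportCert SahiTransportCheck SahiC3Cube SahiComb
open Literature.Combinatorics.Sahi2008
open Literature.Probability.LatticeModels (prodBernoulli sahiE3)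
open Literature.Probability.Percolation (DeterminedBy determinedBy_iff)
open Literature.Probability.Percolation.DecisionTree (ind ind_of_mem ind_of_not_mem ind_nonneg)

variable {ι : Type}

/-! ### Events read off a Boolean function of three memberships -/

/-- `{ω | f(a ∈ ω, b ∈ ω, c ∈ ω)}` for a Boolean function `f`. [this work] -/
def Habc (f : Bool → Bool → Bool → Bool) (a b c : ι) : Set (Set ι) :=
  {ω | f (decide (a ∈ ω)) (decide (b ∈ ω)) (decide (c ∈ ω)) = true}

/-- The bitmask of a Boolean function of three bits. [this work] -/
def maskB (f : Bool → Bool → Bool → Bool) : ℕ := ofBits (fun j => f (j.testBit 0) (j.testBit 1) (j.testBit 2)) 8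

/-- The Boolean function of a bitmask. [this work] -/
def fnB (M : ℕ) : Bool → Bool → Bool → Bool := fun x y z => M.testBit (x.toNat + 2 * y.toNat + 4 * z.toNat)

/-- `maskB (fnB M) = M` for `M < 256`. [this work] -/
theorem maskB_fnB {M : ℕ} (hM : M < 256) : maskB (fnB M) = M := by
  apply Nat.eq_of_testBit_eq
  intro i
  unfold maskB
  rw [testBit_ofBits]
  by_cases hi : i < 8
  · simp only [hi, decide_true, Bool.true_and, fnB]
    congr 1
    interval_cases i <;> decide
  · simp only [hi, decide_false, Bool.false_and]
    symm
    apply Nat.testBit_eq_false_of_lt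
    exact lt_of_lt_of_le hM (by
      calc (256 : ℕ) = 2 ^ 8 := by norm_num
        _ ≤ 2 ^ i := Nat.pow_le_pow_right (by norm_num) (by omega))

/-- `Habc` is determined by the block. [this work] -/
theorem determinedBy_Habc {a b c : ι} (hab : a ≠ b) (hac : a ≠ c) (hbc : b ≠ c) (f : Bool → Bool → Bool → Bool) :
    DeterminedBy (Habc f a b c) (Set.range (e3 hab hac hbc)) :=
  determinedBy_of_abc hab hac hbc fun x y z => f (decide x) (decide y) (decide z) = true

/-- The pattern event of `Habc f` is the bitmask event of `maskB f`. [this work] -/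
theorem pat_Habc {a b c : ι} (hab : a ≠ b) (hac : a ≠ c) (hbc : b ≠ c) (f : Bool → Bool → Bool → Bool) :
    pat (e3 hab hac hbc) (Habc f a b c) = HkM (maskB f) := by
  ext S
  obtain ⟨h0, h1, h2⟩ := mem_image_e3 hab hac hbc S
  rw [mem_pat, mem_HkM]
  simp only [Habc, Set.mem_setOf_eq, h0, h1, h2, mem_iff_testBit_code S]
  unfold maskB
  rw [testBit_ofBits]
  have hc := code_lt S
  simp only [hc, decide_true, Bool.true_and, Bool.decide_eq_true]
  rfl

/-- Two events determined by the block with the same pattern event are equal. [this work] -/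
theorem eq_of_pat_eq {k : ℕ} (e : Fin k ↪ ι) {H H' : Set (Set ι)} (hH : DeterminedBy H (Set.range e)) (hH' : DeterminedBy H' (Set.range e))
    (h : pat e H = pat e H') : H = H' := by
  ext ω
  have hω : plant e (e ⁻¹' ω) ω = ω := by rw [plant_preimage, Set.ite_same]
  rw [← hω, plant_mem_iff e hH, plant_mem_iff e hH', h]

/-- `HkM (encA 3 P) = P`: the bitmask event of an event's own bitmask. [this work] -/
theorem HkM_encA (P : Set (Set (Fin 3))) : HkM (encA 3 P) = P := by
  ext S
  rw [mem_HkM, testBit_encA]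
  have hc : code S < 2 ^ 3 := by have := code_lt S; norm_num; exact this
  simp only [hc, decide_true, Bool.true_and, decide_eq_true_eq, pt_code]

/-- A block-determined event is `Habc` of the Boolean function of its pattern bitmask. [this work] -/
theorem eq_Habc_fnB {a b c : ι} (hab : a ≠ b) (hac : a ≠ c) (hbc : b ≠ c) {H : Set (Set ι)} (hH : DeterminedBy H (Set.range (e3 hab hac hbc))) :
    H = Habc (fnB (encA 3 (pat (e3 hab hac hbc) H))) a b c := by
  refine eq_of_pat_eq (e3 hab hac hbc) hH (determinedBy_Habc hab hac hbc _) ?_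
  rw [pat_Habc, maskB_fnB (lt_of_lt_of_le (encA_lt 3 _) (by norm_num)), HkM_encA]

/-- Identifying `Habc f` with a named event from a pointwise description. [this work] -/
theorem Habc_eq {f : Bool → Bool → Bool → Bool} {a b c : ι} {Q : Set (Set ι)}
    (hQ : ∀ ω : Set ι, ω ∈ Q ↔ f (decide (a ∈ ω)) (decide (b ∈ ω)) (decide (c ∈ ω)) = true) : Habc f a b c = Q := by
  ext ω; rw [hQ]; rfl

/-- The range of the block `(a,b,c)`. [this work] -/
theorem range_e3 {a b c : ι} (hab : a ≠ b) (hac : a ≠ c) (hbc : b ≠ c) : Set.range (e3 hab hac hbc) = ↑({a, b, c} : Finset ι) := by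
  ext x
  simp only [Finset.coe_insert, Finset.coe_singleton, Set.mem_insert_iff, Set.mem_singleton_iff, Set.mem_range]
  constructor
  · rintro ⟨i, rfl⟩; fin_cases i <;> simp [e3]
  · rintro (rfl | rfl | rfl)
    exacts [⟨0, rfl⟩, ⟨1, rfl⟩, ⟨2, rfl⟩]

/-! ### The trivial slots -/

section Measure

variable [Fintype ι]

/-- `E₃(0, g, h) = 0`. [folklore] -/
theorem sahiE_three_empty (p : ι → unitInterval) (U V : Set (Set ι)) :
    sahiE (bernoulliWeight p) 3 ![ind (∅ : Set (Set ι)), ind U, ind V] = 0 := by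
  have h0 : ind (∅ : Set (Set ι)) = fun _ => (0 : ℝ) := funext fun ω => ind_of_not_mem (Set.notMem_empty ω)
  rw [sahiE_three, h0]
  simp [ex]

/-- `E₃(1, g, h) = Cov(g,h) ≥ 0` for increasing events (Harris). [folklore] -/
theorem sahiE_three_univ_nonneg (p : ι → unitInterval) {U V : Set (Set ι)} (hU : IsUpperSet U) (hV : IsUpperSet V) :
    0 ≤ sahiE (bernoulliWeight p) 3 ![ind (Set.univ : Set (Set ι)), ind U, ind V] := by
  have hprod : ∀ X Y : Set (Set ι), ind X * ind Y = ind (X ∩ Y) :=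
    fun X Y => funext fun ω => (Literature.Probability.Percolation.BHK2006.ind_inter X Y ω).symm
  rw [sahiE_three]
  simp only [hprod, Set.univ_inter]
  change 0 ≤ 2 * pr p (U ∩ V) + pr p Set.univ * pr p U * pr p V - (pr p Set.univ * pr p (U ∩ V) + pr p U * pr p V + pr p V * pr p U)
  rw [pr_univ]
  have h := cov_nonneg p hU hV
  nlinarith [h]

/-! ### The theorem -/

/-- Dispatch of the twenty increasing bitmasks (plus a contradiction for the rest): positivity of `E₃(1_{Habc (fnB M)}, 1_U, 1_V)` for `M ∈ upsN 3`.
[this work] -/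
theorem sahiE_three_Habc_nonneg (p : ι → unitInterval) {a b c : ι} (hab : a ≠ b) (hac : a ≠ c) (hbc : b ≠ c) {M : ℕ} (hM : M ∈ upsN 3)
    {U V : Set (Set ι)} (hU : IsUpperSet U) (hV : IsUpperSet V) :
    0 ≤ sahiE (bernoulliWeight p) 3 ![ind (Habc (fnB M) a b c), ind U, ind V] := by
  -- the cylinder, hitting and cylinder-∩-hitting slots through their named forms
  have cyl : ∀ S : Set ι, 0 ≤ sahiE (bernoulliWeight p) 3 ![ind {ω : Set ι | S ⊆ ω}, ind U, ind V] :=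
    fun S => (combPos_sahiE_three_cylinder_head S hU hV).nonneg p
  have hit : ∀ B : Finset ι, 0 ≤ sahiE (bernoulliWeight p) 3 ![ind {ω : Set ι | ∃ x ∈ B, x ∈ ω}, ind U, ind V] :=
    fun B => sahiE_three_hit_nonneg p B hU hV
  have cih : ∀ (S : Set ι) (B : Finset ι), (∀ x ∈ B, x ∉ S) →
      0 ≤ sahiE (bernoulliWeight p) 3 ![ind ({ω : Set ι | S ⊆ ω} ∩ {ω : Set ι | ∃ x ∈ B, x ∈ ω}), ind U, ind V] :=
    fun S B hB => sahiE_three_cylinder_inter_hit_nonneg p S B hB hU hV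
  rw [SahiC4Cube.upsN_three] at hM
  simp only [List.mem_cons, List.not_mem_nil, or_false] at hM
  -- pointwise descriptions: each case is an identity of `Habc (fnB M)` with a named event
  have tac : ∀ (Q : Set (Set ι)) (P : Prop → Prop → Prop → Prop), (∀ ω : Set ι, ω ∈ Q ↔ P (a ∈ ω) (b ∈ ω) (c ∈ ω)) →
      (∀ x y z : Bool, fnB M x y z = true ↔ P (x = true) (y = true) (z = true)) → Habc (fnB M) a b c = Q := by
    intro Q P hQ hP
    refine Habc_eq fun ω => ?_
    rw [hQ, hP]
    simp only [decide_eq_true_eq]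
  rcases hM with rfl | rfl | rfl | rfl | rfl | rfl | rfl | rfl | rfl | rfl | rfl | rfl | rfl | rfl | rfl | rfl | rfl | rfl | rfl | rfl
  · -- 0 : empty
    rw [tac ∅ (fun _ _ _ => False) (fun ω => by simp) (by decide), sahiE_three_empty]
  · -- 128 : abc
    rw [tac {ω | ({a, b, c} : Set ι) ⊆ ω} (fun x y z => x ∧ y ∧ z) (fun ω => by simp [Set.insert_subset_iff]) (by decide)]; exact cyl _
  · -- 136 : ab
    rw [tac {ω | ({a, b} : Set ι) ⊆ ω} (fun x y _ => x ∧ y) (fun ω => by simp [Set.insert_subset_iff]) (by decide)]; exact cyl _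
  · -- 160 : ac
    rw [tac {ω | ({a, c} : Set ι) ⊆ ω} (fun x _ z => x ∧ z) (fun ω => by simp [Set.insert_subset_iff]) (by decide)]; exact cyl _
  · -- 168 : a ∧ (b ∨ c)
    rw [tac ({ω | ({a} : Set ι) ⊆ ω} ∩ {ω | ∃ x ∈ ({b, c} : Finset ι), x ∈ ω}) (fun x y z => x ∧ (y ∨ z))
      (fun ω => by simp) (by decide)]
    exact cih _ _ (fun x hx => by simp at hx ⊢; rcases hx with rfl | rfl <;> [exact fun h => hab h.symm; exact fun h => hac h.symm])
  · -- 170 : a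
    rw [tac {ω | ({a} : Set ι) ⊆ ω} (fun x _ _ => x) (fun ω => by simp) (by decide)]; exact cyl _
  · -- 192 : bc
    rw [tac {ω | ({b, c} : Set ι) ⊆ ω} (fun _ y z => y ∧ z) (fun ω => by simp [Set.insert_subset_iff]) (by decide)]; exact cyl _
  · -- 200 : b ∧ (a ∨ c)
    rw [tac ({ω | ({b} : Set ι) ⊆ ω} ∩ {ω | ∃ x ∈ ({a, c} : Finset ι), x ∈ ω}) (fun x y z => y ∧ (x ∨ z))
      (fun ω => by simp) (by decide)]
    exact cih _ _ (fun x hx => by simp at hx ⊢; rcases hx with rfl | rfl <;> [exact fun h => hab h; exact fun h => hbc h.symm])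
  · -- 204 : b
    rw [tac {ω | ({b} : Set ι) ⊆ ω} (fun _ y _ => y) (fun ω => by simp) (by decide)]; exact cyl _
  · -- 224 : c ∧ (a ∨ b)
    rw [tac ({ω | ({c} : Set ι) ⊆ ω} ∩ {ω | ∃ x ∈ ({a, b} : Finset ι), x ∈ ω}) (fun x y z => z ∧ (x ∨ y))
      (fun ω => by simp) (by decide)]
    exact cih _ _ (fun x hx => by simp at hx ⊢; rcases hx with rfl | rfl <;> [exact fun h => hac h; exact fun h => hbc h])
  · -- 232 : majority
    rw [tac (HMaj a b c) (fun x y z => (x ∧ y) ∨ (x ∧ z) ∨ (y ∧ z)) (fun ω => Iff.rfl) (by decide)]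
    exact sahiE_three_maj_nonneg p hab hac hbc hU hV
  · -- 234 : a ∨ bc
    rw [tac (HOrAnd a b c) (fun x y z => x ∨ (y ∧ z)) (fun ω => Iff.rfl) (by decide)]
    exact sahiE_three_orAnd_nonneg p hab hac hbc hU hV
  · -- 236 : b ∨ ac
    rw [tac (HOrAnd b a c) (fun x y z => y ∨ (x ∧ z)) (fun ω => Iff.rfl) (by decide)]
    exact sahiE_three_orAnd_nonneg p hab.symm hbc hac hU hV
  · -- 238 : a ∨ b
    rw [tac {ω | ∃ x ∈ ({a, b} : Finset ι), x ∈ ω} (fun x y _ => x ∨ y) (fun ω => by simp) (by decide)]; exact hit _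
  · -- 240 : c
    rw [tac {ω | ({c} : Set ι) ⊆ ω} (fun _ _ z => z) (fun ω => by simp) (by decide)]; exact cyl _
  · -- 248 : c ∨ ab
    rw [tac (HOrAnd c a b) (fun x y z => z ∨ (x ∧ y)) (fun ω => Iff.rfl) (by decide)]
    exact sahiE_three_orAnd_nonneg p hac.symm hbc.symm hab hU hV
  · -- 250 : a ∨ c
    rw [tac {ω | ∃ x ∈ ({a, c} : Finset ι), x ∈ ω} (fun x _ z => x ∨ z) (fun ω => by simp) (by decide)]; exact hit _
  · -- 252 : b ∨ c
    rw [tac {ω | ∃ x ∈ ({b, c} : Finset ι), x ∈ ω} (fun _ y z => y ∨ z) (fun ω => by simp) (by decide)]; exact hit _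
  · -- 254 : a ∨ b ∨ c
    rw [tac {ω | ∃ x ∈ ({a, b, c} : Finset ι), x ∈ ω} (fun x y z => x ∨ y ∨ z) (fun ω => by simp) (by decide)]; exact hit _
  · -- 255 : everything
    rw [tac Set.univ (fun _ _ _ => True) (fun ω => by simp) (by decide)]; exact sahiE_three_univ_nonneg p hU hV

/-- **KAHN'S CONJECTURE 5 / SAHI'S `C₃` WHENEVER ONE SLOT DEPENDS ON AT MOST THREE COORDINATES.**  For `|A| ≤ 3`, `H` increasing and
determined by `A`, and ALL increasing `U, V`: `E₃(1_H, 1_U, 1_V) ≥ 0`, in every dimension. [this work] -/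
theorem sahiE_three_nonneg_of_determinedBy_card_le_three (p : ι → unitInterval) (A : Finset ι) (hA : A.card ≤ 3) {H : Set (Set ι)}
    (hH : DeterminedBy H (↑A : Set ι)) (hHu : IsUpperSet H) {U V : Set (Set ι)} (hU : IsUpperSet U) (hV : IsUpperSet V) :
    0 ≤ sahiE (bernoulliWeight p) 3 ![ind H, ind U, ind V] := by
  by_cases hι : Fintype.card ι ≤ 3
  · exact (SahiC3CombCube.combPos_sahiE_three_of_card_le_three hι hHu hU hV).nonneg p
  · -- extend `A` to three distinct coordinates
    obtain ⟨A', hAA', -, hA'⟩ := Finset.exists_subsuperset_card_eq (Finset.subset_univ A) hA (by rw [Finset.card_univ]; omega)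
    obtain ⟨a, b, c, hab, hac, hbc, hA'eq⟩ := Finset.card_eq_three.1 hA'
    have hH' : DeterminedBy H (Set.range (e3 hab hac hbc)) := by
      rw [range_e3, ← hA'eq]; exact hH.mono (Finset.coe_subset.2 hAA')
    rw [eq_Habc_fnB hab hac hbc hH']
    exact sahiE_three_Habc_nonneg p hab hac hbc (encA_mem_upsN (isUpperSet_pat (e3 hab hac hbc) hHu)) hU hV

/-- Law form: `0 ≤ sahiE3 (prodBernoulli p) H U V` whenever `H` is increasing and determined by at most three coordinates and `U, V` are
increasing. [this work] -/
theorem prodBernoulli_sahiE3_nonneg_of_determinedBy_card_le_three (p : ι → unitInterval) (A : Finset ι) (hA : A.card ≤ 3)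
    {H : Set (Set ι)} (hH : DeterminedBy H (↑A : Set ι)) (hHu : IsUpperSet H) {U V : Set (Set ι)} (hU : IsUpperSet U)
    (hV : IsUpperSet V) : 0 ≤ sahiE3 (prodBernoulli p) H U V := by
  rw [← sahiE_three_ind]; exact sahiE_three_nonneg_of_determinedBy_card_le_three p A hA hH hHu hU hV

end Measure

end SahiJuntaSlotThree

end Summit.CriticalPhenomena.PercolationContinuityZ3.Theorems
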